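import Summits.QuantumAdvantage.QuantumAdvantage.Theorems.SosSandwichPseudoBoundedTopPairing
import Summits.QuantumAdvantage.QuantumAdvantage.Theorems.SosSandwichQueryTopLevelWeight
import HarnessLib

/-!
# The contraction estimate of `TopPairing` holds with `K = 1` on `Q_T` (calibration in kernel)

Companion of `Theorems/SosSandwichPseudoBoundedTopPairing.lean` (crux `PseudoBoundedAA`, stmt-QuantumAdvantage-15237).
There the Escudero-Gutiérrez mechanism is transported to the SOS class `K_T`: for `p = Σ_j q_j²` whose data satisfy the
contraction estimate with constant `K`, `∃ k, 4 (W^{=2T}[p])² ≤ K·Inf_k[p]`.  Here we check in kernel that the hypothesis is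
the right abstraction of the quantum case: for the canonical SOS datum of a `T`-query algorithm (real and imaginary
parts of the accepted amplitude polynomials, Beals et al. Lemma 4.1) the contraction estimate holds with **`K = 1`** —
this is `QueryTopLevel.sum_norm_sq_gam_finalState_le` (the creation-operator chain along the algorithm) read through
`Re`/`Im`:

* `re_vfc`, `im_vfc` — the real/imaginary parts of the vector Walsh coefficients of the final state are the Walsh
  coefficients of the real/imaginary amplitude polynomials;
* **`query_contraction_one`** — `∀ A : QQueryAlg N` (`T ≥ 1`) there is an SOS datum `(q_j)` of `A.acceptProb` of degrees
  `≤ T` with contraction constant `1`;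
* `query_topWeight_sq_le_influence'` — consequently `∃ k, 4 (W^{=2T}[p])² ≤ Inf_k[p]` for every polynomial `p` agreeing
  with `A.acceptProb` on the cube, re-derived through the `K_T` interface (the statement of
  `QueryTopLevel.topWeight_sq_le_influence`; nothing new about `Q_T` is claimed).

Together with `TopPairing.contraction_ge_of_addr` (address family: `K ≥ T/4`) this brackets the missing estimate on `K_T`.
All proved, standard axioms.  Sources: EscuderoGutierrez2023 (arXiv:2304.06713) Thm 1.6; BealsEtAl2001 Lemma 4.1.
-/

set_option linter.dupNamespace false

noncomputable section

namespace Summit.QuantumAdvantage.QuantumAdvantage.Theorems.SosSandwich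

open Finset MvPolynomial Literature.Computability.QuantumComplexity Literature.Computability.Cryptography
open Literature.Computability.Complexity.LowDegree Literature.Probability.RandomGraphs.LowDegree
open QueryFourier QueryTopLevel

namespace TopPairing

variable {N : ℕ}

/-! ### Real and imaginary parts of the vector Walsh coefficients -/

/-- `Re v_S(s) = (Re ψ(·,s))^(S)`. [cite: ODonnell2014, §1.2] -/
theorem re_vfc {β : Type*} (ψ : (Fin N → Bool) → β → ℂ) (S : Finset (Fin N)) (s : β) :
    (vfc ψ S s).re = cubeFourierCoeff (fun x => (ψ x s).re) S := by
  unfold vfc cubeFourierCoeff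
  have h2 : (2 : ℂ) ^ N = (((2 : ℝ) ^ N : ℝ) : ℂ) := by push_cast; rfl
  rw [h2, Complex.div_ofReal_re, Complex.re_sum]
  congr 1
  exact Finset.sum_congr rfl fun x _ => Complex.re_mul_ofReal _ _

/-- `Im v_S(s) = (Im ψ(·,s))^(S)`. [cite: ODonnell2014, §1.2] -/
theorem im_vfc {β : Type*} (ψ : (Fin N → Bool) → β → ℂ) (S : Finset (Fin N)) (s : β) :
    (vfc ψ S s).im = cubeFourierCoeff (fun x => (ψ x s).im) S := by
  unfold vfc cubeFourierCoeff
  have h2 : (2 : ℂ) ^ N = (((2 : ℝ) ^ N : ℝ) : ℂ) := by push_cast; rfl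
  rw [h2, Complex.div_ofReal_im, Complex.im_sum]
  congr 1
  exact Finset.sum_congr rfl fun x _ => Complex.im_mul_ofReal _ _

/-- `Γ` evaluated at a coordinate: `Γ(R)(s) = Σ_{U ⊇ R} c_U v_{U∖R}(s)`. [folklore] -/
theorem gam_apply {W : Type*} (c : Finset (Fin N) → ℂ) (T₂ : ℕ) (ψ : (Fin N → Bool) → Fin N × Bool × W → ℂ)
    (R : Finset (Fin N)) (s : Fin N × Bool × W) :
    gam c T₂ ψ R s = ∑ U ∈ Finset.univ.filter (fun U : Finset (Fin N) => U.card = T₂ ∧ R ⊆ U),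
      c U * vfc ψ (U \ R) s := by
  unfold gam
  rw [Finset.sum_apply]
  exact Finset.sum_congr rfl fun U _ => by rw [Pi.smul_apply, smul_eq_mul]

/-! ### The canonical SOS datum of a query algorithm has contraction constant `1` -/

/-- **Contraction constant `1` on `Q_T`.**  For every `T`-query algorithm `A` (`T ≥ 1`) there is an SOS datum
`(q_j)_{j < m}` of total degrees `≤ T` with `A.acceptProb = Σ_j q_j²` on the cube (real and imaginary parts of the
accepted amplitude polynomials) whose top-level coefficients satisfy the contraction estimate of
`TopPairing.topWeight_sq_le_of_contraction` with `K = 1`: for all real weights `c` on the `2T`-subsets and all `M`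
with `Σ_{|U| = 2T, U ∋ k} c_U² ≤ M` (every `k`), `Σ_j Σ_{|R| = T} (Σ_{U ⊇ R, |U| = 2T} c_U q̂_j(U ∖ R))² ≤ M`.
(Proof: `Σ_j Γ_j(R)² = Σ_{s accepted} |Γ[ψ](R)(s)|² ≤ ‖Γ[ψ](R)‖²` for the complex weights `c/√M`, and
`Σ_R ‖Γ[ψ](R)‖² ≤ 1` is `QueryTopLevel.sum_norm_sq_gam_finalState_le`.) [cite: EscuderoGutierrez2023, Thm 1.6 (proof)]
[cite: BealsEtAl2001, Lemma 4.1] -/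
theorem query_contraction_one (A : QQueryAlg N) (hT : 1 ≤ A.queries) :
    ∃ (m : ℕ) (q : Fin m → MvPolynomial (Fin N) ℝ), (∀ j, (q j).totalDegree ≤ A.queries) ∧
      (∀ x, A.acceptProb x = ∑ j, evalBool (q j) x ^ 2) ∧
      ∀ (c : Finset (Fin N) → ℝ) (M : ℝ),
        (∀ k : Fin N, ∑ U ∈ Finset.univ.filter (fun U : Finset (Fin N) => U.card = 2 * A.queries ∧ k ∈ U),
          c U ^ 2 ≤ M) →
        ∑ j, ∑ R ∈ Finset.univ.filter (fun R : Finset (Fin N) => R.card = A.queries),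
          (∑ U ∈ Finset.univ.filter (fun U : Finset (Fin N) => U.card = 2 * A.queries ∧ R ⊆ U),
            c U * cubeFourierCoeff (evalBool (q j)) (U \ R)) ^ 2 ≤ 1 * M := by
  classical
  choose P Q hP hQ h using fun s => hasDegreeLE_finalState A s
  beta_reduce at h
  -- real and imaginary parts of the amplitudes
  have hre : ∀ s x, (A.finalState x s).re = evalBool (P s) x := fun s x => by
    have e1 : evalBool (P s) x = MvPolynomial.eval (Literature.Computability.Complexity.Multilinear.boolPt (R := ℝ) x) (P s) := rfl
    rw [h s x, e1]; simp
  have him : ∀ s x, (A.finalState x s).im = evalBool (Q s) x := fun s x => by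
    have e1 : evalBool (Q s) x = MvPolynomial.eval (Literature.Computability.Complexity.Multilinear.boolPt (R := ℝ) x) (Q s) := rfl
    rw [h s x, e1]; simp
  -- index: (basis state, real/imaginary part)
  set ι := (Fin N × Bool × A.W) × Bool with hι
  set e : ι ≃ Fin (Fintype.card ι) := Fintype.equivFin ι with he
  set qf : ι → MvPolynomial (Fin N) ℝ :=
    fun sb => if sb.1 ∈ A.accept then (if sb.2 then P sb.1 else Q sb.1) else 0 with hqf
  have hnorm : ∀ (x : Fin N → Bool) (s : Fin N × Bool × A.W),
      ‖A.finalState x s‖ ^ 2 = evalBool (P s) x ^ 2 + evalBool (Q s) x ^ 2 := by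
    intro x s
    rw [Complex.sq_norm, Complex.normSq_apply, hre, him]
    ring
  refine ⟨Fintype.card ι, fun j => qf (e.symm j), fun j => ?_, fun x => ?_, fun c M hc => ?_⟩
  · simp only [hqf]
    split_ifs
    · exact hP _
    · exact hQ _
    · simp
  · rw [Equiv.sum_comp e.symm (fun sb => evalBool (qf sb) x ^ 2), Fintype.sum_prod_type]
    simp only [Fintype.sum_bool]
    unfold QQueryAlg.acceptProb
    rw [Finset.sum_filter]
    refine Finset.sum_congr rfl fun s _ => ?_
    split_ifs with hs
    · simp only [hqf, hs, if_true]
      simp only [Bool.false_eq_true, if_false]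
      rw [hnorm x s]
    · have hev0 : evalBool (0 : MvPolynomial (Fin N) ℝ) x = 0 := map_zero (MvPolynomial.eval _)
      simp [hqf, hs, hev0]
  · -- the contraction estimate with `K = 1`
    set T := A.queries with hTdef
    set FR := Finset.univ.filter (fun R : Finset (Fin N) => R.card = T) with hFR
    set Γ : ι → Finset (Fin N) → ℝ := fun sb R =>
      ∑ U ∈ Finset.univ.filter (fun U : Finset (Fin N) => U.card = 2 * T ∧ R ⊆ U),
        c U * cubeFourierCoeff (evalBool (qf sb)) (U \ R) with hΓ
    -- reindex `Fin m → ι` and exchange the sums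
    have hreidx : ∑ j, ∑ R ∈ FR, (∑ U ∈ Finset.univ.filter (fun U : Finset (Fin N) => U.card = 2 * T ∧ R ⊆ U),
          c U * cubeFourierCoeff (evalBool (qf (e.symm j))) (U \ R)) ^ 2 =
        ∑ R ∈ FR, ∑ sb : ι, Γ sb R ^ 2 := by
      rw [Equiv.sum_comp e.symm (fun sb => ∑ R ∈ FR, Γ sb R ^ 2), Finset.sum_comm]
    rw [hreidx, one_mul]
    -- sign of `M`: there is an index, so `0 ≤ Σ_{U ∋ k} c_U² ≤ M`
    have hM0 : 0 ≤ M := (Finset.sum_nonneg fun U _ => sq_nonneg (c U)).trans (hc A.start.1)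
    -- every relevant `U` contains an index, so `M = 0` kills all weights
    have hU_mem : ∀ U : Finset (Fin N), U.card = 2 * T → ∃ k, k ∈ U := fun U hU => by
      have : U.Nonempty := by rw [← Finset.card_pos, hU]; omega
      exact this
    by_cases hMz : M = 0
    · have hc0 : ∀ U : Finset (Fin N), U.card = 2 * T → c U = 0 := by
        intro U hU
        obtain ⟨k, hk⟩ := hU_mem U hU
        have hle : c U ^ 2 ≤ ∑ U' ∈ Finset.univ.filter (fun U' : Finset (Fin N) => U'.card = 2 * T ∧ k ∈ U'),
            c U' ^ 2 :=
          Finset.single_le_sum (f := fun U' => c U' ^ 2) (fun U' _ => sq_nonneg _)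
            (Finset.mem_filter.mpr ⟨Finset.mem_univ U, hU, hk⟩)
        have := (hle.trans (hc k)).trans hMz.le
        exact pow_eq_zero_iff (n := 2) (by norm_num) |>.mp (le_antisymm this (sq_nonneg _))
      have hΓ0 : ∀ sb R, Γ sb R = 0 := fun sb R => by
        simp only [hΓ]
        refine Finset.sum_eq_zero fun U hU => ?_
        rw [Finset.mem_filter] at hU
        rw [hc0 U hU.2.1, zero_mul]
      rw [hMz]
      refine le_of_eq (Finset.sum_eq_zero fun R _ => Finset.sum_eq_zero fun sb _ => ?_)
      rw [hΓ0]; ring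
    · have hMpos : 0 < M := lt_of_le_of_ne hM0 (Ne.symm hMz)
      have hsq : 0 < Real.sqrt M := Real.sqrt_pos.mpr hMpos
      -- complex weights `c/√M`
      set c' : Finset (Fin N) → ℂ := fun U => ((c U / Real.sqrt M : ℝ) : ℂ) with hc'
      have hc'norm : ∀ U, ‖c' U‖ ^ 2 = c U ^ 2 / M := fun U => by
        simp only [hc']
        rw [Complex.norm_real, Real.norm_eq_abs, sq_abs, div_pow, Real.sq_sqrt hM0]
      have hc'1 : ∀ k : Fin N,
          ∑ U ∈ Finset.univ.filter (fun U : Finset (Fin N) => U.card = 2 * T ∧ k ∈ U), ‖c' U‖ ^ 2 ≤ 1 := by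
        intro k
        simp_rw [hc'norm]
        rw [← Finset.sum_div, div_le_one hMpos]
        exact hc k
      have hchain := sum_norm_sq_gam_finalState_le A hT c' hc'1
      -- `Γ_{(s,re)}(R) = √M · Re Γ'[ψ](R)(s)` and the same for `Im`, on accepted `s`; zero otherwise
      have hΓre : ∀ s R, s ∈ A.accept →
          Γ (s, true) R = Real.sqrt M * (gam c' (2 * T) (fun x => A.finalState x) R s).re := by
        intro s R hs
        simp only [hΓ, hqf, hs, if_true]
        rw [gam_apply, Complex.re_sum, Finset.mul_sum]
        refine Finset.sum_congr rfl fun U _ => ?_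
        simp only [hc']
        rw [Complex.re_ofReal_mul, re_vfc]
        have hfun : (fun x => (A.finalState x s).re) = evalBool (P s) := funext fun x => hre s x
        rw [hfun]
        field_simp
      have hΓim : ∀ s R, s ∈ A.accept →
          Γ (s, false) R = Real.sqrt M * (gam c' (2 * T) (fun x => A.finalState x) R s).im := by
        intro s R hs
        simp only [hΓ, hqf, hs, if_true, Bool.false_eq_true, if_false]
        rw [gam_apply, Complex.im_sum, Finset.mul_sum]
        refine Finset.sum_congr rfl fun U _ => ?_
        simp only [hc']
        rw [Complex.im_ofReal_mul, im_vfc]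
        have hfun : (fun x => (A.finalState x s).im) = evalBool (Q s) := funext fun x => him s x
        rw [hfun]
        field_simp
      have hΓout : ∀ s R (b : Bool), s ∉ A.accept → Γ (s, b) R = 0 := by
        intro s R b hs
        simp only [hΓ, hqf, hs, if_false]
        refine Finset.sum_eq_zero fun U _ => ?_
        have hev0 : evalBool (0 : MvPolynomial (Fin N) ℝ) = fun _ => 0 :=
          funext fun x => map_zero (MvPolynomial.eval _)
        rw [hev0]
        have : cubeFourierCoeff (fun _ : Fin N → Bool => (0 : ℝ)) (U \ R) = 0 := by
          unfold cubeFourierCoeff; simp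
        rw [this, mul_zero]
      -- per `R`: `Σ_{sb} Γ_sb(R)² ≤ M · ‖Γ'[ψ](R)‖²`
      have hperR : ∀ R, ∑ sb : ι, Γ sb R ^ 2 ≤
          M * ∑ s, ‖gam c' (2 * T) (fun x => A.finalState x) R s‖ ^ 2 := by
        intro R
        rw [Fintype.sum_prod_type, Finset.mul_sum]
        refine Finset.sum_le_sum fun s _ => ?_
        simp only [Fintype.sum_bool]
        by_cases hs : s ∈ A.accept
        · rw [hΓre s R hs, hΓim s R hs, Complex.sq_norm, Complex.normSq_apply, mul_pow, mul_pow,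
            Real.sq_sqrt hM0]
          nlinarith [sq_nonneg (gam c' (2 * T) (fun x => A.finalState x) R s).re,
            sq_nonneg (gam c' (2 * T) (fun x => A.finalState x) R s).im]
        · rw [hΓout s R true hs, hΓout s R false hs]
          have : 0 ≤ M * ‖gam c' (2 * T) (fun x => A.finalState x) R s‖ ^ 2 := by positivity
          linarith
      calc ∑ R ∈ FR, ∑ sb : ι, Γ sb R ^ 2
          ≤ ∑ R ∈ FR, M * ∑ s, ‖gam c' (2 * T) (fun x => A.finalState x) R s‖ ^ 2 :=
            Finset.sum_le_sum fun R _ => hperR R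
        _ = M * ∑ R ∈ FR, ∑ s, ‖gam c' (2 * T) (fun x => A.finalState x) R s‖ ^ 2 := by
            rw [Finset.mul_sum]
        _ ≤ M * 1 := mul_le_mul_of_nonneg_left hchain hM0
        _ = M := mul_one M

/-- **The `Q_T` top-weight inequality, re-derived through the `K_T` interface.**  For every `T`-query algorithm
(`T ≥ 1`) and every polynomial `p` agreeing with its acceptance probability on the cube, `∃ k, 4 (W^{=2T}[p])² ≤ Inf_k[p]`
— `query_contraction_one` fed into `TopPairing.topWeight_sq_le_of_contraction` (this is the statement of
`QueryTopLevel.topWeight_sq_le_influence`; the point is only that the `K_T` reduction loses nothing on `Q_T`).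
[cite: EscuderoGutierrez2023, Thm 1.6] -/
theorem query_topWeight_sq_le_influence' (A : QQueryAlg N) (hT : 1 ≤ A.queries) (p : MvPolynomial (Fin N) ℝ)
    (hp : ∀ x, evalBool p x = A.acceptProb x) :
    ∃ k : Fin N, 4 * (∑ U ∈ Finset.univ.filter (fun U : Finset (Fin N) => U.card = 2 * A.queries),
        cubeFourierCoeff (evalBool p) U ^ 2) ^ 2 ≤ influence k p := by
  obtain ⟨m, q, hq, hacc, hK⟩ := query_contraction_one A hT
  have hN : 0 < N := Fin.pos A.start.1
  have hp' : ∀ x, evalBool p x = ∑ j, evalBool (q j) x ^ 2 := fun x => by rw [hp x, hacc x]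
  have hp1 : ∀ x, evalBool p x ≤ 1 := fun x => by rw [hp x]; exact QQueryAlg.acceptProb_le_one_holds A x
  obtain ⟨k, hk⟩ := topWeight_sq_le_of_contraction hT hN q hq p hp' hp1 1 hK
  exact ⟨k, by simpa only [one_mul] using hk⟩

end TopPairing

end Summit.QuantumAdvantage.QuantumAdvantage.Theorems.SosSandwich

end
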